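import Mathlib
import Literature.MathematicalPhysics.QuantumManyBody.PeriodicBoseGasEq317
import Literature.MathematicalPhysics.QuantumManyBody.PeriodicTorusCalculus
import Literature.MathematicalPhysics.QuantumManyBody.WeightedCorrector
import Literature.MathematicalPhysics.QuantumManyBody.PeriodicConfigFourier

/-!
# Route BECInfDivCoherence — `LevyMassCondensation`: the translation coherence of a periodic state

Helper file (supports `stmt-AtomisticToContinuum-9117`). For a periodic `C¹` trial state `Ψ` of
`N` bosons on the torus of side `L` (`PeriodicTrialState`) and a particle `i`, the **translation
coherence** `G(r) = Re ∫_{cell^N} conj Ψ(…, xᵢ + r, …) Ψ(X) dX` (written out, no definition;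
`update X i (X i + r) = X + eᵢ ⊗ r` is `update_eq_add_single` of `PeriodicConfigFourier.lean`)
satisfies

* `coh_zero` — `G(0) = 1` (normalisation);
* `coh_add_single` — `G(r + L e_k) = G(r)` (periodicity);
* `one_sub_coh_eq` — `1 - G(r) = ½ ∫_{cell^N} |Ψ(X + r eᵢ) - Ψ(X)|² dX` (shift invariance of the
  cell integral, `lintegral_cellN_comp_add`), whence `coh_le_one`;
* `lintegral_translate_sub_sq_le` — `∫ |Ψ(X + s e_{ik}) - Ψ(X)|² ≤ s² ∫ |∂_{ik}Ψ|²` (fundamental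
  theorem of calculus along the segment, Cauchy–Schwarz, Tonelli, shift invariance);
* `one_sub_coh_le` — the **kinetic short-distance bound** `1 - G(s e_k) ≤ (s²/2) ∫ |∂_{ik}Ψ|²`;
* `exists_particle_kinetic_le` — a particle whose kinetic energy is `≤ T/N` (pigeonhole).

References: E. H. Lieb, R. Seiringer, J. P. Solovej, J. Yngvason, *The Mathematics of the Bose Gas
and its Condensation* (2005), §1.2 (one-body density matrix); S. Stringari, in *Bose–Einstein
Condensation* (CUP 1995), §2 (kinetic sum rule for the coherence).
-/

noncomputable section

namespace Summit.AtomisticToContinuum.BoseEinsteinCondensation.Theorems.InfDivGlue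

open MeasureTheory Set Literature.MathematicalPhysics.QuantumManyBody.BoseGas
open scoped ENNReal ComplexConjugate

variable {N : ℕ} {L : ℝ}

/-- `∫_{cell^N} ‖F‖² = (∫⁻_{cell^N} ‖F‖₊²).toReal` for continuous `F`. [folklore] -/
theorem integral_cellN_norm_sq_eq_toReal (L : ℝ) {F : Config N → ℂ} (hF : Continuous F) :
    ∫ X in cellN N L, ‖F X‖ ^ 2 = (∫⁻ X in cellN N L, (‖F X‖₊ : ℝ≥0∞) ^ 2).toReal := by
  have hc : Continuous fun X => ‖F X‖ ^ 2 := hF.norm.pow 2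
  rw [← ENNReal.toReal_ofReal (integral_nonneg fun X => by positivity),
    ofReal_integral_eq_lintegral_ofReal (integrableOn_cellN hc L) (ae_of_all _ fun X => by positivity)]
  congr 1
  refine lintegral_congr fun X => ?_
  rw [ENNReal.ofReal_pow (norm_nonneg _), ofReal_norm, enorm_eq_nnnorm]

/-- **Shift invariance of the norm**: `∫⁻_{cell^N} ‖Ψ(X + C)‖₊² = 1`. [folklore] -/
theorem lintegral_norm_sq_translate (hL : 0 < L) (Ψ : PeriodicTrialState N L) (C : Config N) :
    ∫⁻ X in cellN N L, (‖Ψ.ψ (X + C)‖₊ : ℝ≥0∞) ^ 2 = 1 := by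
  rw [lintegral_cellN_comp_add hL (G := fun X => (‖Ψ.ψ X‖₊ : ℝ≥0∞) ^ 2)
    (fun X i k => by simp only [Ψ.periodic]) C]
  exact Ψ.norm_eq

/-- **Normalisation of the coherence**: `G(0) = 1`. [folklore] -/
theorem coh_zero (Ψ : PeriodicTrialState N L) (i : Fin N) :
    (∫ X in cellN N L, conj (Ψ.ψ (Function.update X i (X i + 0))) * Ψ.ψ X).re = 1 := by
  simp_rw [add_zero, Function.update_eq_self]
  have h1 : ∀ X, conj (Ψ.ψ X) * Ψ.ψ X = ((‖Ψ.ψ X‖ ^ 2 : ℝ) : ℂ) := fun X => by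
    rw [Complex.conj_mul', Complex.ofReal_pow]
  simp_rw [h1]
  rw [integral_complex_ofReal, Complex.ofReal_re,
    integral_cellN_norm_sq_eq_toReal L Ψ.contDiff.continuous, Ψ.norm_eq, ENNReal.toReal_one]

/-- **Periodicity of the coherence**: `G(r + L e_k) = G(r)`. [folklore] -/
theorem coh_add_single (Ψ : PeriodicTrialState N L) (i : Fin N) (r : Space) (k : Fin 3) :
    (∫ X in cellN N L, conj (Ψ.ψ (Function.update X i (X i + (r + EuclideanSpace.single k L)))) *
        Ψ.ψ X).re =
      (∫ X in cellN N L, conj (Ψ.ψ (Function.update X i (X i + r))) * Ψ.ψ X).re := by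
  congr 1
  refine integral_congr_ae (ae_of_all _ fun X => ?_)
  simp only
  rw [update_eq_add_single, update_eq_add_single, Pi.single_add, ← add_assoc, Ψ.periodic]

/-- **The coherence through the `L²`-increment**:
`1 - G(r) = ½ ∫_{cell^N} ‖Ψ(X + eᵢ ⊗ r) - Ψ(X)‖² dX` (expand the square; both translates have norm
`1` by shift invariance of the cell integral). [folklore] -/
theorem one_sub_coh_eq (hL : 0 < L) (Ψ : PeriodicTrialState N L) (i : Fin N) (r : Space) :
    1 - (∫ X in cellN N L, conj (Ψ.ψ (Function.update X i (X i + r))) * Ψ.ψ X).re =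
      (1 / 2) * ∫ X in cellN N L, ‖Ψ.ψ (X + Pi.single i r) - Ψ.ψ X‖ ^ 2 := by
  have hc := Ψ.contDiff.continuous
  have hcT : Continuous fun X : Config N => Ψ.ψ (X + Pi.single i r) := hc.comp (by fun_prop)
  simp_rw [update_eq_add_single]
  -- pointwise expansion of the square
  have hpt : ∀ X : Config N, ‖Ψ.ψ (X + Pi.single i r) - Ψ.ψ X‖ ^ 2 =
      ‖Ψ.ψ (X + Pi.single i r)‖ ^ 2 + ‖Ψ.ψ X‖ ^ 2 -
        2 * (conj (Ψ.ψ (X + Pi.single i r)) * Ψ.ψ X).re := by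
    intro X
    rw [← Complex.normSq_eq_norm_sq, ← Complex.normSq_eq_norm_sq, ← Complex.normSq_eq_norm_sq,
      Complex.normSq_sub]
    congr 2
    rw [← Complex.conj_re, map_mul, Complex.conj_conj]
  simp_rw [hpt]
  have hi1 : Integrable (fun X => ‖Ψ.ψ (X + Pi.single i r)‖ ^ 2) (volume.restrict (cellN N L)) :=
    integrableOn_cellN (hcT.norm.pow 2) L
  have hi2 : Integrable (fun X => ‖Ψ.ψ X‖ ^ 2) (volume.restrict (cellN N L)) :=
    integrableOn_cellN (hc.norm.pow 2) L
  have hi3 : Integrable (fun X => conj (Ψ.ψ (X + Pi.single i r)) * Ψ.ψ X)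
      (volume.restrict (cellN N L)) :=
    integrableOn_cellN ((Complex.continuous_conj.comp hcT).mul hc) L
  have hi4 : Integrable (fun X => 2 * (conj (Ψ.ψ (X + Pi.single i r)) * Ψ.ψ X).re)
      (volume.restrict (cellN N L)) :=
    (integrableOn_cellN ((Complex.continuous_re.comp ((Complex.continuous_conj.comp hcT).mul hc)))
      L).const_mul 2
  have hre : ∫ X in cellN N L, (conj (Ψ.ψ (X + Pi.single i r)) * Ψ.ψ X).re =
      (∫ X in cellN N L, conj (Ψ.ψ (X + Pi.single i r)) * Ψ.ψ X).re := by
    have := integral_re hi3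
    simpa using this
  have e1 : ∫ X in cellN N L, ‖Ψ.ψ (X + Pi.single i r)‖ ^ 2 = 1 := by
    rw [integral_cellN_norm_sq_eq_toReal L hcT, lintegral_norm_sq_translate hL Ψ, ENNReal.toReal_one]
  have e2 : ∫ X in cellN N L, ‖Ψ.ψ X‖ ^ 2 = 1 := by
    rw [integral_cellN_norm_sq_eq_toReal L hc, Ψ.norm_eq, ENNReal.toReal_one]
  have e3 : ∫ X in cellN N L, 2 * (conj (Ψ.ψ (X + Pi.single i r)) * Ψ.ψ X).re =
      2 * (∫ X in cellN N L, conj (Ψ.ψ (X + Pi.single i r)) * Ψ.ψ X).re := by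
    rw [integral_const_mul, hre]
  have h := integral_sub (hi1.add hi2) hi4
  have h' := integral_add hi1 hi2
  simp only [Pi.add_apply] at h
  rw [h', e1, e2, e3] at h
  rw [h]
  ring

/-- `G(r) ≤ 1`. [folklore] -/
theorem coh_le_one (hL : 0 < L) (Ψ : PeriodicTrialState N L) (i : Fin N) (r : Space) :
    (∫ X in cellN N L, conj (Ψ.ψ (Function.update X i (X i + r))) * Ψ.ψ X).re ≤ 1 := by
  have h := one_sub_coh_eq hL Ψ i r
  have h0 : 0 ≤ (1 / 2) * ∫ X in cellN N L, ‖Ψ.ψ (X + Pi.single i r) - Ψ.ψ X‖ ^ 2 :=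
    mul_nonneg (by norm_num) (integral_nonneg fun X => by positivity)
  linarith

/-- `(∫⁻_{[0,1]} f)² ≤ ∫⁻_{[0,1]} f²` (Cauchy–Schwarz on a probability space). [folklore] -/
theorem lintegral_Icc_sq_le {f : ℝ → ℝ≥0∞} (hf : AEMeasurable f (volume.restrict (Icc (0 : ℝ) 1))) :
    (∫⁻ τ in Icc (0 : ℝ) 1, f τ) ^ 2 ≤ ∫⁻ τ in Icc (0 : ℝ) 1, f τ ^ 2 := by
  have hH := ENNReal.lintegral_mul_le_Lp_mul_Lq (volume.restrict (Icc (0 : ℝ) 1))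
    Real.HolderConjugate.two_two hf aemeasurable_const (g := fun _ => 1)
  simp only [Pi.mul_apply, mul_one, ENNReal.one_rpow, lintegral_const,
    Measure.restrict_apply_univ, Real.volume_Icc, sub_zero, ENNReal.ofReal_one] at hH
  have h2 := pow_le_pow_left' hH 2
  rw [← ENNReal.rpow_natCast, ← ENNReal.rpow_natCast, ← ENNReal.rpow_mul] at h2
  norm_num at h2
  simpa [ENNReal.rpow_two] using h2

/-- **Translation bound in `L²` by the kinetic energy**: for the coordinate direction
`e = eᵢ ⊗ e_k` and `s ∈ ℝ`, `∫_{cell^N} ‖Ψ(X + s e) - Ψ(X)‖² ≤ s² ∫_{cell^N} ‖∂_e Ψ‖²` (FTC along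
`τ ↦ X + τ s e`, Cauchy–Schwarz in `τ`, Tonelli, shift invariance of the cell integral of the
periodic function `‖∂_eΨ‖²`). [folklore] -/
theorem lintegral_translate_sub_sq_le (hL : 0 < L) (Ψ : PeriodicTrialState N L) (i : Fin N)
    (k : Fin 3) (s : ℝ) :
    ∫⁻ X in cellN N L, (‖Ψ.ψ (X + s • (Pi.single i (EuclideanSpace.single k (1 : ℝ)) : Config N)) -
        Ψ.ψ X‖₊ : ℝ≥0∞) ^ 2 ≤
      ENNReal.ofReal (s ^ 2) * ∫⁻ X in cellN N L,
        (‖fderiv ℝ Ψ.ψ X (Pi.single i (EuclideanSpace.single k (1 : ℝ)))‖₊ : ℝ≥0∞) ^ 2 := by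
  set e : Config N := Pi.single i (EuclideanSpace.single k (1 : ℝ)) with he
  set D : Config N → ℂ := fun X => fderiv ℝ Ψ.ψ X e with hD
  have hdiff : Differentiable ℝ Ψ.ψ := Ψ.contDiff.differentiable one_ne_zero
  have hDcont : Continuous D :=
    (Ψ.contDiff.continuous_fderiv one_ne_zero).clm_apply continuous_const
  have hDper : ∀ (X : Config N) (j : Fin N) (c : Fin 3),
      D (X + Pi.single j (EuclideanSpace.single c L)) = D X :=
    fun X j c => fderiv_apply_periodic Ψ.periodic e X j c
  -- pointwise: FTC + Cauchy–Schwarz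
  have hpt : ∀ X : Config N, (‖Ψ.ψ (X + s • e) - Ψ.ψ X‖₊ : ℝ≥0∞) ^ 2 ≤
      ENNReal.ofReal (s ^ 2) * ∫⁻ τ in Icc (0 : ℝ) 1, (‖D (X + (τ * s) • e)‖₊ : ℝ≥0∞) ^ 2 := by
    intro X
    have hseg : ∀ τ : ℝ, HasDerivAt (fun τ : ℝ => X + (τ * s) • e) (s • e) τ := by
      intro τ
      have h := (((hasDerivAt_id τ).mul_const s).smul_const e).const_add X
      simpa using h
    have hderiv : ∀ τ : ℝ, HasDerivAt (fun τ : ℝ => Ψ.ψ (X + (τ * s) • e))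
        (s • D (X + (τ * s) • e)) τ := by
      intro τ
      have h := (hdiff (X + (τ * s) • e)).hasFDerivAt.comp_hasDerivAt τ (hseg τ)
      have h' : fderiv ℝ Ψ.ψ (X + (τ * s) • e) (s • e) = s • D (X + (τ * s) • e) := by
        rw [hD, map_smul]
      rw [← h']
      exact h
    have hpath : Continuous fun τ : ℝ => X + (τ * s) • e := by fun_prop
    have hcont' : Continuous fun τ : ℝ => s • D (X + (τ * s) • e) :=
      (hDcont.comp hpath).const_smul s
    have hFTC : ∫ τ in (0 : ℝ)..1, s • D (X + (τ * s) • e) = Ψ.ψ (X + s • e) - Ψ.ψ X := by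
      have := intervalIntegral.integral_eq_sub_of_hasDerivAt (a := 0) (b := 1)
        (fun τ _ => hderiv τ) (hcont'.intervalIntegrable _ _)
      simpa using this
    have hmeas : AEMeasurable (fun τ : ℝ => ‖D (X + (τ * s) • e)‖ₑ)
        (volume.restrict (Icc (0 : ℝ) 1)) :=
      (hDcont.comp hpath).measurable.enorm.aemeasurable
    calc (‖Ψ.ψ (X + s • e) - Ψ.ψ X‖₊ : ℝ≥0∞) ^ 2
        = ‖∫ τ in Icc (0 : ℝ) 1, s • D (X + (τ * s) • e)‖ₑ ^ 2 := by
          rw [← hFTC, intervalIntegral.integral_of_le zero_le_one, integral_Icc_eq_integral_Ioc,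
            enorm_eq_nnnorm]
      _ ≤ (∫⁻ τ in Icc (0 : ℝ) 1, ‖s • D (X + (τ * s) • e)‖ₑ) ^ 2 := by
          gcongr
          exact enorm_integral_le_lintegral_enorm _
      _ = (ENNReal.ofReal |s| * ∫⁻ τ in Icc (0 : ℝ) 1, (‖D (X + (τ * s) • e)‖₊ : ℝ≥0∞)) ^ 2 := by
          congr 1
          simp_rw [enorm_smul]
          rw [lintegral_const_mul'' _ hmeas, Real.enorm_eq_ofReal_abs]
          simp_rw [enorm_eq_nnnorm]
      _ = ENNReal.ofReal (s ^ 2) * (∫⁻ τ in Icc (0 : ℝ) 1, (‖D (X + (τ * s) • e)‖₊ : ℝ≥0∞)) ^ 2 := by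
          rw [mul_pow, ← ENNReal.ofReal_pow (abs_nonneg _), sq_abs]
      _ ≤ ENNReal.ofReal (s ^ 2) * ∫⁻ τ in Icc (0 : ℝ) 1, (‖D (X + (τ * s) • e)‖₊ : ℝ≥0∞) ^ 2 := by
          gcongr
          exact lintegral_Icc_sq_le hmeas
  -- integrate over the cell, swap, and shift
  have hpath2 : Continuous fun p : Config N × ℝ => p.1 + (p.2 * s) • e := by fun_prop
  have hK : Measurable fun p : Config N × ℝ => (‖D (p.1 + (p.2 * s) • e)‖₊ : ℝ≥0∞) ^ 2 :=
    (ENNReal.continuous_coe.comp (hDcont.comp hpath2).nnnorm).measurable.pow_const 2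
  calc ∫⁻ X in cellN N L, (‖Ψ.ψ (X + s • e) - Ψ.ψ X‖₊ : ℝ≥0∞) ^ 2
      ≤ ∫⁻ X in cellN N L, ENNReal.ofReal (s ^ 2) *
          ∫⁻ τ in Icc (0 : ℝ) 1, (‖D (X + (τ * s) • e)‖₊ : ℝ≥0∞) ^ 2 := lintegral_mono hpt
    _ = ENNReal.ofReal (s ^ 2) * ∫⁻ X in cellN N L,
          ∫⁻ τ in Icc (0 : ℝ) 1, (‖D (X + (τ * s) • e)‖₊ : ℝ≥0∞) ^ 2 := by
        rw [lintegral_const_mul'' _ ((hK.lintegral_prod_right').aemeasurable)]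
    _ = ENNReal.ofReal (s ^ 2) * ∫⁻ τ in Icc (0 : ℝ) 1,
          ∫⁻ X in cellN N L, (‖D (X + (τ * s) • e)‖₊ : ℝ≥0∞) ^ 2 := by
        rw [lintegral_lintegral_swap (f := fun (X : Config N) (τ : ℝ) =>
          (‖D (X + (τ * s) • e)‖₊ : ℝ≥0∞) ^ 2) hK.aemeasurable]
    _ = ENNReal.ofReal (s ^ 2) * ∫⁻ _τ in Icc (0 : ℝ) 1,
          ∫⁻ X in cellN N L, (‖D X‖₊ : ℝ≥0∞) ^ 2 := by
        congr 1
        refine lintegral_congr fun τ => ?_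
        exact lintegral_cellN_comp_add hL (G := fun X => (‖D X‖₊ : ℝ≥0∞) ^ 2)
          (fun X j c => by simp only [hDper]) ((τ * s) • e)
    _ = ENNReal.ofReal (s ^ 2) * ∫⁻ X in cellN N L, (‖D X‖₊ : ℝ≥0∞) ^ 2 := by
        rw [lintegral_const, Measure.restrict_apply_univ, Real.volume_Icc, sub_zero,
          ENNReal.ofReal_one, mul_one]

/-- **Kinetic short-distance bound for the coherence**:
`1 - G(s e_k) ≤ (s²/2) ∫_{cell^N} |∂_{ik}Ψ|²`. [folklore] -/
theorem one_sub_coh_le (hL : 0 < L) (Ψ : PeriodicTrialState N L) (i : Fin N) (k : Fin 3)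
    (s : ℝ)
    (hfin : (∫⁻ X in cellN N L,
      (‖fderiv ℝ Ψ.ψ X (Pi.single i (EuclideanSpace.single k (1 : ℝ)))‖₊ : ℝ≥0∞) ^ 2) ≠ ⊤) :
    1 - (∫ X in cellN N L, conj (Ψ.ψ (Function.update X i (X i + s • EuclideanSpace.single k (1 : ℝ)))) *
        Ψ.ψ X).re ≤
      s ^ 2 / 2 * (∫⁻ X in cellN N L,
        (‖fderiv ℝ Ψ.ψ X (Pi.single i (EuclideanSpace.single k (1 : ℝ)))‖₊ : ℝ≥0∞) ^ 2).toReal := by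
  rw [one_sub_coh_eq hL Ψ i]
  have hc := Ψ.contDiff.continuous
  have hsingle : (Pi.single i (s • EuclideanSpace.single k (1 : ℝ)) : Config N) =
      s • (Pi.single i (EuclideanSpace.single k (1 : ℝ)) : Config N) := by
    rw [Pi.single_smul]
  have hcT : Continuous fun X : Config N =>
      Ψ.ψ (X + s • (Pi.single i (EuclideanSpace.single k (1 : ℝ)) : Config N)) - Ψ.ψ X :=
    (hc.comp (by fun_prop)).sub hc
  rw [hsingle, integral_cellN_norm_sq_eq_toReal L hcT]
  have h := lintegral_translate_sub_sq_le hL Ψ i k s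
  have h2 := ENNReal.toReal_mono (ENNReal.mul_ne_top ENNReal.ofReal_ne_top hfin) h
  rw [ENNReal.toReal_mul, ENNReal.toReal_ofReal (sq_nonneg _)] at h2
  have : s ^ 2 / 2 * (∫⁻ X in cellN N L,
      (‖fderiv ℝ Ψ.ψ X (Pi.single i (EuclideanSpace.single k (1 : ℝ)))‖₊ : ℝ≥0∞) ^ 2).toReal =
      (1 / 2) * (s ^ 2 * (∫⁻ X in cellN N L,
      (‖fderiv ℝ Ψ.ψ X (Pi.single i (EuclideanSpace.single k (1 : ℝ)))‖₊ : ℝ≥0∞) ^ 2).toReal) := by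
    ring
  rw [this]
  exact mul_le_mul_of_nonneg_left h2 (by norm_num)

/-- **Pigeonhole on the kinetic energy**: some particle carries at most `T/N` of a total kinetic
energy `≤ T`. [folklore] -/
theorem exists_particle_kinetic_le (Ψ : PeriodicTrialState N L) (hN : 0 < N) {T : ℝ≥0∞}
    (hT : (∫⁻ X in cellN N L, kineticDensity Ψ.ψ X) ≤ T) :
    ∃ i : Fin N, (∑ k : Fin 3, ∫⁻ X in cellN N L,
      (‖fderiv ℝ Ψ.ψ X (Pi.single i (EuclideanSpace.single k (1 : ℝ)))‖₊ : ℝ≥0∞) ^ 2) ≤ T / N := by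
  have hmeas : ∀ (i : Fin N) (k : Fin 3), Measurable fun X : Config N =>
      (‖fderiv ℝ Ψ.ψ X (Pi.single i (EuclideanSpace.single k (1 : ℝ)))‖₊ : ℝ≥0∞) ^ 2 :=
    fun i k => (ENNReal.continuous_coe.comp ((Ψ.contDiff.continuous_fderiv one_ne_zero).clm_apply
      continuous_const).nnnorm).measurable.pow_const 2
  have hsum : (∫⁻ X in cellN N L, kineticDensity Ψ.ψ X) = ∑ i : Fin N, ∑ k : Fin 3,
      ∫⁻ X in cellN N L,
        (‖fderiv ℝ Ψ.ψ X (Pi.single i (EuclideanSpace.single k (1 : ℝ)))‖₊ : ℝ≥0∞) ^ 2 := by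
    unfold kineticDensity
    rw [lintegral_finsetSum _ fun i _ => Finset.measurable_sum _ fun k _ => hmeas i k]
    exact Finset.sum_congr rfl fun i _ => lintegral_finsetSum _ fun k _ => hmeas i k
  by_contra hcon
  push Not at hcon
  have hNe : (Finset.univ : Finset (Fin N)).Nonempty := Finset.univ_nonempty_iff.2 ⟨⟨0, hN⟩⟩
  have hlt := ENNReal.sum_lt_sum_of_nonempty hNe fun i _ => hcon i
  rw [Finset.sum_const, Finset.card_univ, Fintype.card_fin, nsmul_eq_mul, ← hsum] at hlt
  have hN0 : (N : ℝ≥0∞) ≠ 0 := Nat.cast_ne_zero.2 hN.ne'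
  rw [ENNReal.mul_div_cancel hN0 (ENNReal.natCast_ne_top N)] at hlt
  exact absurd (hlt.trans_le hT) (lt_irrefl _)

end Summit.AtomisticToContinuum.BoseEinsteinCondensation.Theorems.InfDivGlue

end
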